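import Summits.QuantumFields.YangMills.Theorems.BalabanUVNodesN18TwoRunLetters
import Literature.MathematicalPhysics.QuantumFieldTheory.Balaban1983to89.NodeOLettersSqrt

/-!
# BalabanUVNodes ∕ N18 — THE TWO-RUN CLOSENESS-LETTER CALCULUS, PART 1 (PRODUCTS): the END's two-run closeness letters
# (C1) ∕ (C2) of `N18TwoRunLetters.termWalkData_of_staticLetters_at_window` for the PRODUCT of two static kernel families,
# from the letters of the factors — the walk-free «difference of propagators on one line» (Track A, DAG node N18 = NE5
# `T4OutputRate.NE5 EA EB W κ θ C₅`; cluster K4 «SpineRates»; in the currency of `…N18TwoRunLetters` §3∕§4 and `…N18EndLetters`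
# («the END from letters», p433335)); part 2 (sums ∕ scalars ∕ monotonicity ∕ INVERSES ∕ SQUARE ROOT) is the companion module
# `BalabanUVNodesN18TwoRunLettersCalculusResolvent`

Cell `pub-ymgap`, HUMAN RULING D-0149 (T⁴ apex work-bound push), width seat `pub-ymgap-dag-n18-w1` (g0); W-SEAT-START-LIST v3 §2 n18 item 1
(«`N18At` at the record … start from `…N18EndLetters` ∕ `…N18TwoRunLetters` currency»), SUB-LEMMA «two-run closeness-letter calculus».
`--kind proof --supports stmt-QuantumFields-20544` (K3⁷ `SpineGivenEndpointR13SepCoPH`) as a HELPER — COUNT-NEUTRAL.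

HONEST FRAMING.  Finite-matrix bookkeeping (entrywise exponential majorants composed through volume sums); THEOREMS ONLY, 0 `def`,
0 `sorry`, standard axioms.  Every letter is a HYPOTHESIS about abstract static kernel families `σ ↦ K(σ)`; nothing of Bałaban's `Γ_k`,
`Δ^{(k)}(Z₀,σ,𝐔,𝐉)`, `C^{(k)}`, `(C^{(k)})^{1/2}` is constructed or asserted; the PRIMITIVE two-run closeness letters (the η-rate of rows NE2∕NE3
for Bałaban's propagators at two lattice spacings; NODE O's instance 0∕1) are NOT supplied here or anywhere in the tree.  NE5 is NOT IN
PRINT ([Balaban1987RG1] Thm 1 p. 259: uniformity in ε only) and NOT PROVED; N18 NOT discharged; counts UNMOVED (typed 28∕28 · discharged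
5∕27); one finite four-torus programme at fixed ε — NOT continuum, NOT ℝ⁴, NOT OS, NOT a mass gap, NOT Clay.

THE POINT.  «The END from letters» (`N18EndLetters.n18_family_of_endLetters`) reduces N18's K4 family shape to NODE O's σ-only letters
(L1) plain decay `‖K(σ)_{ij}‖ ≤ B·e^{−ρd₁(i,j)}`, (L2) σ-localisation through `X` `‖(K(σ) − K(0))_{ij}‖ ≤ B′·e^{−ρd_X(i,j)}` for BOTH runs'
Γ-kernel and precision, plus the TWO-RUN CLOSENESS LETTERS at rows NE2∕NE3's rate `ϱ`:
(C1) `‖K_B(σ)_{ij} − K_A(σ)_{ij}‖ ≤ ϱ·(B·e^{−ρd₁(i,j)})`, (C2) `‖(K_B(σ)−K_B(0))_{ij} − (K_A(σ)−K_A(0))_{ij}‖ ≤ ϱ·(B′·e^{−ρd_X(i,j)})`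
(binders `hcloseΓ hlocΓ hcloseE hlocE` of `N18TwoRunLetters.termWalkData_of_staticLetters_at_window`).  The record's Γ-kernel and precision are
COMPOSITE operators — `Γ_k(Z₀,σ,𝐔,𝐉) = C*Δ_k(σ)C_{Z₀ᶜ}(C^{(k)})^{1/2}(σ)`, `(C^{(k)})^{1/2} = (C*Δ_kC)^{−1/2}` ([Balaban1988RG2Cluster] (2.7) p. 13,
p. 15) — while the η-rate, when it is produced, is produced for PRIMITIVES (propagators, averaging operators, minimisers: the printed model is
[King1986] Prop. 3.9 (3.73) p. 665 with the mechanism p. 665 *"the error is the same graph with a difference of propagators on one line"*).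
The tree has the ONE-run product rule (`NodeOLettersSqrt.kernelLetters_mul`: (L1)–(L3) of `K₁K₂`) and the ONE-run square-root rule
(`kernelLetters_invSqrt`), but no TWO-run rule.  THIS FILE (part 1) and its companion (part 2) are the two-run rule, in the END's literal
binder shapes.  HERE:
* §1 generic entrywise product bounds (σ-free): `exp_mul_exp_le_split` (the rate split `e^{−ρa}e^{−ρb} ≤ e^{−ρ′x}e^{−ηa}`, `x ≤ a + b`,
  `ρ′ + η ≤ ρ`), `norm_mul_apply_le_of_decay` (`d₁·d₁ → d₁`), `norm_mul_apply_le_of_decayX_left` (`d_X·d₁ → d_X`),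
  `norm_mul_apply_le_of_decayX_right` (`d₁·d_X → d_X`) — amplitudes multiply, one volume sum `c_V` at the margin `η`.
* §2 PRODUCTS: `close_mul` — (C1) of `K₁K₂` from (L1) of `K₁^A, K₂^B` (amplitudes `B₁, B₂`) and (C1) of both pairs (amplitudes `D₁, D₂`): rate `ϱ`,
  amplitude `(D₁B₂ + B₁D₂)c_V` (King's `ε_A·b + a·ε_B`, p. 675), decay `ρ′` (`K₁^BK₂^B − K₁^AK₂^A = (K₁^B − K₁^A)K₂^B + K₁^A(K₂^B − K₂^A)`: one
  differenced line at a time); `locClose_mul` — (C2) of `K₁K₂` from (L1)(L2)(C1)(C2) of the factors: amplitude `(D₁′B₂ + B₁′D₂ + D₁B₂′ + B₁D₂′)c_V`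
  (four one-line-differenced terms through `X`).  At `Dᵢ = Bᵢ`, `Dᵢ′ = Bᵢ′` (the END's convention: the closeness amplitude IS the letter
  amplitude) these are twice `kernelLetters_mul`'s (L1)∕(L2) amplitudes `B₁B₂c_V`, `(B₁′B₂ + B₁B₂′)c_V` of the product — re-matched to one
  letter block by part 2's `close_mono`.
IN PART 2 (`…N18TwoRunLettersCalculusResolvent`): sums ∕ scalars ∕ monotonicity ∕ symmetry; INVERSES `close_inv` ((C1) of `σ ↦ (A(σ))⁻¹` by
the resolvent identity, the precision slot's (L4)∕(C3) currency); SQUARE ROOT `close_invSqrt` ((C1) of `σ ↦ (P(σ))^{−1/2}` =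
`B13Sqrt27Accretive.norm_invSqrt_sub_apply_le` at `T := P_B(σ), T′ := P_A(σ)`); the Γ-KERNEL SHAPE `close_mul_invSqrt` ((C1) of
`σ ↦ K(σ)·(P(σ))^{−1/2}`, «local factor × square root of the covariance» [Balaban1988RG2Cluster] p. 13, end to end from the factors' letters).
NOT COVERED (honest): (C2) of the square-root factor (a second-order resolvent expansion — four resolvents; follow-on); (L3)∕holomorphy
(one-run, `kernelLetters_mul`); any letter for Bałaban's actual primitives (rows NE2∕NE3 ∕ NODE O); the END's other binders.

Sources (mechanism and shapes only; nothing printed is asserted): T. Bałaban, CMP **116** (1988) [Balaban1988RG2Cluster] (1.11) p. 5, (2.7)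
p. 13, p. 15, (2.16) p. 16; CMP **99** (1985) [Balaban1985BackgroundPropagators] (3.93) p. 410, Thm 3.10 p. 416; CMP **96** (1984)
[Balaban1984PropagatorsII] (2.54)–(2.56) p. 233 (composition of exponential majorants through a row sum); C. King, CMP **102** (1986) [King1986]
p. 665.  Nothing here is a claim about the Yang–Mills mass gap.
-/

noncomputable section

namespace Summit.QuantumFields.YangMills.BalabanUVNodes.N18TwoRunLettersCalculus

open Metric Set Finset
open scoped Matrix
open Literature.MathematicalPhysics.QuantumFieldTheory.Balaban1983to89
open Literature.MathematicalPhysics.QuantumFieldTheory.Balaban1983to89.B9Thm37GlueTorus (tdist1 tdist1_nonneg tdist1_triangle tdist1_self)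
open Literature.MathematicalPhysics.QuantumFieldTheory.Balaban1983to89.TreeLengthTorus (TPt)
open Literature.MathematicalPhysics.QuantumFieldTheory.Balaban1983to89.B5TorusCover (UT)
open Literature.MathematicalPhysics.QuantumFieldTheory.Balaban1983to89.NodeOLetters (distX distX_nonneg)
open Literature.MathematicalPhysics.QuantumFieldTheory.Balaban1983to89.NodeOLettersSqrt (distX_le_tdist1_add)

variable {d N' : ℕ} {ν : ℕ} {Nf : Fin ν → ℕ} [∀ i, NeZero (Nf i)]

/-! ## §1 Generic entrywise product bounds: one volume sum, amplitudes multiply, the rate loses the margin `η` -/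

section Generic

variable {p q n : Type} [Fintype q]

omit [∀ i, NeZero (Nf i)] in
/-- **The rate split**: `e^{−ρa}·e^{−ρb} ≤ e^{−ρ′x}·e^{−ηa}` whenever `x ≤ a + b`, `0 ≤ a, b`, `0 ≤ ρ′, η`, `ρ′ + η ≤ ρ` — the margin `η` is the
rate at which the volume sum over the middle index is taken. [cite: Balaban1984PropagatorsII, (2.54)–(2.56) p.233] -/
theorem exp_mul_exp_le_split {ρ ρ' η a b x : ℝ} (hρ' : 0 ≤ ρ') (hη : 0 ≤ η) (hsplit : ρ' + η ≤ ρ) (ha : 0 ≤ a) (hb : 0 ≤ b)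
    (hx : x ≤ a + b) :
    Real.exp (-(ρ * a)) * Real.exp (-(ρ * b)) ≤ Real.exp (-(ρ' * x)) * Real.exp (-(η * a)) := by
  rw [← Real.exp_add, ← Real.exp_add]
  apply Real.exp_le_exp.2
  nlinarith [mul_le_mul_of_nonneg_left hx hρ', mul_nonneg hη hb, mul_nonneg (sub_nonneg.2 hsplit) (add_nonneg ha hb)]

/-- **`d₁·d₁ → d₁`**: a `p × q` matrix decaying at rate `ρ` in the located torus distance with amplitude `a` times a `q × n` one with amplitude
`b`, volume sums `Σ_k e^{−ηd₁(loc i, loc k)} ≤ c_V` over the middle index ⟹ the product decays at any rate `ρ′ ≥ 0` with `ρ′ + η ≤ ρ`, amplitude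
`a·b·c_V` (triangle inequality for `d₁` and the rate split). [cite: Balaban1984PropagatorsII, (2.54)–(2.56) p.233; Balaban1985BackgroundPropagators, Thm 3.10 p.416] -/
theorem norm_mul_apply_le_of_decay (locp : p → UT Nf) (locq : q → UT Nf) (locn : n → UT Nf)
    {M₁ : Matrix p q ℂ} {M₂ : Matrix q n ℂ} {a b ρ ρ' η cV : ℝ}
    (ha : 0 ≤ a) (hb : 0 ≤ b) (hρ' : 0 ≤ ρ') (hη : 0 ≤ η) (hsplit : ρ' + η ≤ ρ)
    (h₁ : ∀ i k, ‖M₁ i k‖ ≤ a * Real.exp (-(ρ * tdist1 Nf (locp i) (locq k))))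
    (h₂ : ∀ k j, ‖M₂ k j‖ ≤ b * Real.exp (-(ρ * tdist1 Nf (locq k) (locn j))))
    (hvol : ∀ i, ∑ k, Real.exp (-(η * tdist1 Nf (locp i) (locq k))) ≤ cV) (i : p) (j : n) :
    ‖(M₁ * M₂) i j‖ ≤ a * b * cV * Real.exp (-(ρ' * tdist1 Nf (locp i) (locn j))) := by
  have hcV : 0 ≤ cV := (Finset.sum_nonneg fun k _ => (Real.exp_pos _).le).trans (hvol i)
  rw [Matrix.mul_apply]
  calc ‖∑ k, M₁ i k * M₂ k j‖ ≤ ∑ k, ‖M₁ i k * M₂ k j‖ := norm_sum_le _ _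
    _ ≤ ∑ k, (a * Real.exp (-(ρ * tdist1 Nf (locp i) (locq k)))) * (b * Real.exp (-(ρ * tdist1 Nf (locq k) (locn j)))) :=
        Finset.sum_le_sum fun k _ => (norm_mul_le _ _).trans
          (mul_le_mul (h₁ i k) (h₂ k j) (norm_nonneg _) (mul_nonneg ha (Real.exp_pos _).le))
    _ ≤ ∑ k, a * b * (Real.exp (-(ρ' * tdist1 Nf (locp i) (locn j))) * Real.exp (-(η * tdist1 Nf (locp i) (locq k)))) := by
        refine Finset.sum_le_sum fun k _ => ?_
        have hk := exp_mul_exp_le_split hρ' hη hsplit (tdist1_nonneg (locp i) (locq k)) (tdist1_nonneg (locq k) (locn j))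
          (tdist1_triangle (locp i) (locq k) (locn j))
        calc (a * Real.exp (-(ρ * tdist1 Nf (locp i) (locq k)))) * (b * Real.exp (-(ρ * tdist1 Nf (locq k) (locn j))))
            = a * b * (Real.exp (-(ρ * tdist1 Nf (locp i) (locq k))) * Real.exp (-(ρ * tdist1 Nf (locq k) (locn j)))) := by ring
          _ ≤ a * b * (Real.exp (-(ρ' * tdist1 Nf (locp i) (locn j))) * Real.exp (-(η * tdist1 Nf (locp i) (locq k)))) :=
              mul_le_mul_of_nonneg_left hk (mul_nonneg ha hb)
    _ = a * b * Real.exp (-(ρ' * tdist1 Nf (locp i) (locn j))) * ∑ k, Real.exp (-(η * tdist1 Nf (locp i) (locq k))) := by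
        rw [Finset.mul_sum]; exact Finset.sum_congr rfl fun k _ => by ring
    _ ≤ a * b * Real.exp (-(ρ' * tdist1 Nf (locp i) (locn j))) * cV :=
        mul_le_mul_of_nonneg_left (hvol i) (mul_nonneg (mul_nonneg ha hb) (Real.exp_pos _).le)
    _ = a * b * cV * Real.exp (-(ρ' * tdist1 Nf (locp i) (locn j))) := by ring

/-- **`d_X·d₁ → d_X`**: the left factor decays THROUGH `X` (`d_X`, `X ≠ ∅`), the right one in `d₁`; volume sums over the middle index on the
RIGHT factor's side `Σ_k e^{−ηd₁(loc k, loc j)} ≤ c_V` ⟹ the product decays through `X` at rate `ρ′`, amplitude `a·b·c_V` (through-domination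
`d_X(i,j) ≤ d_X(i,k) + d₁(k,j)`, `NodeOLettersSqrt.distX_le_tdist1_add`). [cite: Balaban1985BackgroundPropagators, (3.93) p.410, Thm 3.10 p.416] -/
theorem norm_mul_apply_le_of_decayX_left (locp : p → UT Nf) (locq : q → UT Nf) (locn : n → UT Nf) {X : Finset (UT Nf)}
    (hX : X.Nonempty) {M₁ : Matrix p q ℂ} {M₂ : Matrix q n ℂ} {a b ρ ρ' η cV : ℝ}
    (ha : 0 ≤ a) (hb : 0 ≤ b) (hρ' : 0 ≤ ρ') (hη : 0 ≤ η) (hsplit : ρ' + η ≤ ρ)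
    (h₁ : ∀ i k, ‖M₁ i k‖ ≤ a * Real.exp (-(ρ * distX X (locp i) (locq k))))
    (h₂ : ∀ k j, ‖M₂ k j‖ ≤ b * Real.exp (-(ρ * tdist1 Nf (locq k) (locn j))))
    (hvol' : ∀ j, ∑ k, Real.exp (-(η * tdist1 Nf (locq k) (locn j))) ≤ cV) (i : p) (j : n) :
    ‖(M₁ * M₂) i j‖ ≤ a * b * cV * Real.exp (-(ρ' * distX X (locp i) (locn j))) := by
  rw [Matrix.mul_apply]
  calc ‖∑ k, M₁ i k * M₂ k j‖ ≤ ∑ k, ‖M₁ i k * M₂ k j‖ := norm_sum_le _ _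
    _ ≤ ∑ k, (a * Real.exp (-(ρ * distX X (locp i) (locq k)))) * (b * Real.exp (-(ρ * tdist1 Nf (locq k) (locn j)))) :=
        Finset.sum_le_sum fun k _ => (norm_mul_le _ _).trans
          (mul_le_mul (h₁ i k) (h₂ k j) (norm_nonneg _) (mul_nonneg ha (Real.exp_pos _).le))
    _ ≤ ∑ k, a * b * (Real.exp (-(ρ' * distX X (locp i) (locn j))) * Real.exp (-(η * tdist1 Nf (locq k) (locn j)))) := by
        refine Finset.sum_le_sum fun k _ => ?_
        have hx : distX X (locp i) (locn j) ≤ tdist1 Nf (locq k) (locn j) + distX X (locp i) (locq k) := by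
          have h := distX_le_tdist1_add hX (locp i) (locp i) (locq k) (locn j)
          rw [tdist1_self, zero_add] at h
          linarith
        have hk := exp_mul_exp_le_split hρ' hη hsplit (tdist1_nonneg (locq k) (locn j)) (distX_nonneg X (locp i) (locq k)) hx
        calc (a * Real.exp (-(ρ * distX X (locp i) (locq k)))) * (b * Real.exp (-(ρ * tdist1 Nf (locq k) (locn j))))
            = a * b * (Real.exp (-(ρ * tdist1 Nf (locq k) (locn j))) * Real.exp (-(ρ * distX X (locp i) (locq k)))) := by ring
          _ ≤ a * b * (Real.exp (-(ρ' * distX X (locp i) (locn j))) * Real.exp (-(η * tdist1 Nf (locq k) (locn j)))) :=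
              mul_le_mul_of_nonneg_left hk (mul_nonneg ha hb)
    _ = a * b * Real.exp (-(ρ' * distX X (locp i) (locn j))) * ∑ k, Real.exp (-(η * tdist1 Nf (locq k) (locn j))) := by
        rw [Finset.mul_sum]; exact Finset.sum_congr rfl fun k _ => by ring
    _ ≤ a * b * Real.exp (-(ρ' * distX X (locp i) (locn j))) * cV :=
        mul_le_mul_of_nonneg_left (hvol' j) (mul_nonneg (mul_nonneg ha hb) (Real.exp_pos _).le)
    _ = a * b * cV * Real.exp (-(ρ' * distX X (locp i) (locn j))) := by ring

/-- **`d₁·d_X → d_X`**: the left factor decays in `d₁`, the right one THROUGH `X`; volume sums over the middle index on the LEFT factor's side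
`Σ_k e^{−ηd₁(loc i, loc k)} ≤ c_V` ⟹ the product decays through `X` at rate `ρ′`, amplitude `a·b·c_V` (`d_X(i,j) ≤ d₁(i,k) + d_X(k,j)`).
[cite: Balaban1985BackgroundPropagators, (3.93) p.410, Thm 3.10 p.416] -/
theorem norm_mul_apply_le_of_decayX_right (locp : p → UT Nf) (locq : q → UT Nf) (locn : n → UT Nf) {X : Finset (UT Nf)}
    (hX : X.Nonempty) {M₁ : Matrix p q ℂ} {M₂ : Matrix q n ℂ} {a b ρ ρ' η cV : ℝ}
    (ha : 0 ≤ a) (hb : 0 ≤ b) (hρ' : 0 ≤ ρ') (hη : 0 ≤ η) (hsplit : ρ' + η ≤ ρ)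
    (h₁ : ∀ i k, ‖M₁ i k‖ ≤ a * Real.exp (-(ρ * tdist1 Nf (locp i) (locq k))))
    (h₂ : ∀ k j, ‖M₂ k j‖ ≤ b * Real.exp (-(ρ * distX X (locq k) (locn j))))
    (hvol : ∀ i, ∑ k, Real.exp (-(η * tdist1 Nf (locp i) (locq k))) ≤ cV) (i : p) (j : n) :
    ‖(M₁ * M₂) i j‖ ≤ a * b * cV * Real.exp (-(ρ' * distX X (locp i) (locn j))) := by
  rw [Matrix.mul_apply]
  calc ‖∑ k, M₁ i k * M₂ k j‖ ≤ ∑ k, ‖M₁ i k * M₂ k j‖ := norm_sum_le _ _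
    _ ≤ ∑ k, (a * Real.exp (-(ρ * tdist1 Nf (locp i) (locq k)))) * (b * Real.exp (-(ρ * distX X (locq k) (locn j)))) :=
        Finset.sum_le_sum fun k _ => (norm_mul_le _ _).trans
          (mul_le_mul (h₁ i k) (h₂ k j) (norm_nonneg _) (mul_nonneg ha (Real.exp_pos _).le))
    _ ≤ ∑ k, a * b * (Real.exp (-(ρ' * distX X (locp i) (locn j))) * Real.exp (-(η * tdist1 Nf (locp i) (locq k)))) := by
        refine Finset.sum_le_sum fun k _ => ?_
        have hx : distX X (locp i) (locn j) ≤ tdist1 Nf (locp i) (locq k) + distX X (locq k) (locn j) := by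
          have h := distX_le_tdist1_add hX (locp i) (locq k) (locn j) (locn j)
          rw [tdist1_self, add_zero] at h
          exact h
        have hk := exp_mul_exp_le_split hρ' hη hsplit (tdist1_nonneg (locp i) (locq k)) (distX_nonneg X (locq k) (locn j)) hx
        calc (a * Real.exp (-(ρ * tdist1 Nf (locp i) (locq k)))) * (b * Real.exp (-(ρ * distX X (locq k) (locn j))))
            = a * b * (Real.exp (-(ρ * tdist1 Nf (locp i) (locq k))) * Real.exp (-(ρ * distX X (locq k) (locn j)))) := by ring
          _ ≤ a * b * (Real.exp (-(ρ' * distX X (locp i) (locn j))) * Real.exp (-(η * tdist1 Nf (locp i) (locq k)))) :=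
              mul_le_mul_of_nonneg_left hk (mul_nonneg ha hb)
    _ = a * b * Real.exp (-(ρ' * distX X (locp i) (locn j))) * ∑ k, Real.exp (-(η * tdist1 Nf (locp i) (locq k))) := by
        rw [Finset.mul_sum]; exact Finset.sum_congr rfl fun k _ => by ring
    _ ≤ a * b * Real.exp (-(ρ' * distX X (locp i) (locn j))) * cV :=
        mul_le_mul_of_nonneg_left (hvol i) (mul_nonneg (mul_nonneg ha hb) (Real.exp_pos _).le)
    _ = a * b * cV * Real.exp (-(ρ' * distX X (locp i) (locn j))) := by ring

end Generic

omit [∀ i, NeZero (Nf i)] in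
/-- `σ = 0` lies in the polydisc `‖σ_j‖ ≤ e^{κ₁}` (plumbing). [folklore] -/
private theorem zero_mem_polydisc (c : B13.Consts) : ∀ j, ‖(0 : TPt d N' → ℂ) j‖ ≤ Real.exp c.κ₁ :=
  fun _ => by simpa using (Real.exp_pos c.κ₁).le

/-! ## §2 PRODUCTS: the two-run closeness letters (C1) ∕ (C2) of `σ ↦ K₁(σ)K₂(σ)` from the factors' letters -/

section Product

variable {p q n : Type} [Fintype q] {c : B13.Consts}
  {locp : p → UT Nf} {locq : q → UT Nf} {locn : n → UT Nf}
  {KA₁ KB₁ : (TPt d N' → ℂ) → Matrix p q ℂ} {KA₂ KB₂ : (TPt d N' → ℂ) → Matrix q n ℂ}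
  {X : Finset (UT Nf)} {ρ ρ' η cV ϱ B₁ B₁' B₂ B₂' D₁ D₁' D₂ D₂' : ℝ}

/-- **(C1) OF A PRODUCT — «the difference of propagators on one line», walk-free.**  Static run-A ∕ run-B families `K₁^A, K₁^B : p × q` and
`K₂^A, K₂^B : q × n` on the polydisc `‖σ_j‖ ≤ e^{κ₁}`; (L1) plain decay of `K₁^A` (amplitude `B₁`) and of `K₂^B` (amplitude `B₂`) at rate `ρ`; the two-run
closeness letter (C1) for BOTH pairs at rate `ϱ ≥ 0` with amplitudes `D₁`, `D₂` (the differenced lines) at rate `ρ`; volume sums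
`Σ_k e^{−ηd₁(loc i, loc k)} ≤ c_V` over the middle bonds ⟹ (C1) for the products `σ ↦ K₁^B(σ)K₂^B(σ)` vs `σ ↦ K₁^A(σ)K₂^A(σ)` at rate `ϱ`, amplitude
`(D₁B₂ + B₁D₂)·c_V` (King's `ε_A·b + a·ε_B`; `= 2B₁B₂c_V` when `Dᵢ = Bᵢ`), decay `ρ′` (`ρ′ + η ≤ ρ`):
`K₁^BK₂^B − K₁^AK₂^A = (K₁^B − K₁^A)K₂^B + K₁^A(K₂^B − K₂^A)` and §1 twice. [cite: King1986, p.665 and p.675; Balaban1988RG2Cluster, (1.11) p.5, (2.16) p.16] -/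
theorem close_mul (hϱ : 0 ≤ ϱ) (hB₁ : 0 ≤ B₁) (hB₂ : 0 ≤ B₂) (hD₁ : 0 ≤ D₁) (hD₂ : 0 ≤ D₂) (hρ' : 0 ≤ ρ') (hη : 0 ≤ η) (hsplit : ρ' + η ≤ ρ)
    (hA₁ : ∀ σ : TPt d N' → ℂ, (∀ j, ‖σ j‖ ≤ Real.exp c.κ₁) →
      ∀ i k, ‖KA₁ σ i k‖ ≤ B₁ * Real.exp (-(ρ * tdist1 Nf (locp i) (locq k))))
    (hB₂d : ∀ σ : TPt d N' → ℂ, (∀ j, ‖σ j‖ ≤ Real.exp c.κ₁) →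
      ∀ k j, ‖KB₂ σ k j‖ ≤ B₂ * Real.exp (-(ρ * tdist1 Nf (locq k) (locn j))))
    (hclose₁ : ∀ σ : TPt d N' → ℂ, (∀ j, ‖σ j‖ ≤ Real.exp c.κ₁) →
      ∀ i k, ‖KB₁ σ i k - KA₁ σ i k‖ ≤ ϱ * (D₁ * Real.exp (-(ρ * tdist1 Nf (locp i) (locq k)))))
    (hclose₂ : ∀ σ : TPt d N' → ℂ, (∀ j, ‖σ j‖ ≤ Real.exp c.κ₁) →
      ∀ k j, ‖KB₂ σ k j - KA₂ σ k j‖ ≤ ϱ * (D₂ * Real.exp (-(ρ * tdist1 Nf (locq k) (locn j)))))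
    (hvol : ∀ i, ∑ k, Real.exp (-(η * tdist1 Nf (locp i) (locq k))) ≤ cV) :
    ∀ σ : TPt d N' → ℂ, (∀ j, ‖σ j‖ ≤ Real.exp c.κ₁) →
      ∀ i j, ‖(KB₁ σ * KB₂ σ) i j - (KA₁ σ * KA₂ σ) i j‖
        ≤ ϱ * (((D₁ * B₂ + B₁ * D₂) * cV) * Real.exp (-(ρ' * tdist1 Nf (locp i) (locn j)))) := by
  intro σ hσ i j
  have hsplitM : KB₁ σ * KB₂ σ - KA₁ σ * KA₂ σ = (KB₁ σ - KA₁ σ) * KB₂ σ + KA₁ σ * (KB₂ σ - KA₂ σ) := by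
    rw [Matrix.sub_mul, Matrix.mul_sub]; abel
  have t1 := norm_mul_apply_le_of_decay locp locq locn (M₁ := KB₁ σ - KA₁ σ) (M₂ := KB₂ σ) (a := ϱ * D₁) (b := B₂)
    (mul_nonneg hϱ hD₁) hB₂ hρ' hη hsplit (fun i k => by rw [Matrix.sub_apply, mul_assoc]; exact hclose₁ σ hσ i k) (hB₂d σ hσ) hvol i j
  have t2 := norm_mul_apply_le_of_decay locp locq locn (M₁ := KA₁ σ) (M₂ := KB₂ σ - KA₂ σ) (a := B₁) (b := ϱ * D₂)
    hB₁ (mul_nonneg hϱ hD₂) hρ' hη hsplit (hA₁ σ hσ) (fun k j => by rw [Matrix.sub_apply, mul_assoc]; exact hclose₂ σ hσ k j) hvol i j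
  rw [← Matrix.sub_apply, hsplitM, Matrix.add_apply]
  calc ‖((KB₁ σ - KA₁ σ) * KB₂ σ) i j + (KA₁ σ * (KB₂ σ - KA₂ σ)) i j‖
      ≤ ‖((KB₁ σ - KA₁ σ) * KB₂ σ) i j‖ + ‖(KA₁ σ * (KB₂ σ - KA₂ σ)) i j‖ := norm_add_le _ _
    _ ≤ ϱ * D₁ * B₂ * cV * Real.exp (-(ρ' * tdist1 Nf (locp i) (locn j)))
        + B₁ * (ϱ * D₂) * cV * Real.exp (-(ρ' * tdist1 Nf (locp i) (locn j))) := add_le_add t1 t2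
    _ = ϱ * (((D₁ * B₂ + B₁ * D₂) * cV) * Real.exp (-(ρ' * tdist1 Nf (locp i) (locn j)))) := by ring

/-- **(C2) OF A PRODUCT.**  With `Δᵢ^R(σ) := Kᵢ^R(σ) − Kᵢ^R(0)` the σ-localised pieces,
`[K₁^BK₂^B(σ) − K₁^BK₂^B(0)] − [K₁^AK₂^A(σ) − K₁^AK₂^A(0)] = (Δ₁^B − Δ₁^A)K₂^B(σ) + Δ₁^A(K₂^B(σ) − K₂^A(σ)) + (K₁^B(0) − K₁^A(0))Δ₂^B + K₁^A(0)(Δ₂^B − Δ₂^A)`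
— four terms, each a product with ONE differenced line carrying the rate `ϱ` and ONE factor localised through `X`.  Hypotheses: (L1) of `K₁^A` and
`K₂^B` (amplitudes `B₁, B₂`), (L2) of `K₁^A` and `K₂^B` (amplitudes `B₁′, B₂′`), (C1) (amplitudes `D₁, D₂`) and (C2) (amplitudes `D₁′, D₂′`) of both
pairs at rate `ϱ ≥ 0`, all at decay `ρ`; volume sums on both sides; `X ≠ ∅` ⟹ (C2) for the products at rate `ϱ`, amplitude
`(D₁′B₂ + B₁′D₂ + D₁B₂′ + B₁D₂′)·c_V` (`= 2(B₁′B₂ + B₁B₂′)c_V` when `Dᵢ = Bᵢ`, `Dᵢ′ = Bᵢ′`), decay `ρ′` (`ρ′ + η ≤ ρ`).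
[cite: King1986, p.665; Balaban1988RG2Cluster, (1.11) p.5, p.13, (2.16) p.16; Balaban1985BackgroundPropagators, (3.93) p.410] -/
theorem locClose_mul (hX : X.Nonempty) (hϱ : 0 ≤ ϱ) (hB₁ : 0 ≤ B₁) (hB₁' : 0 ≤ B₁') (hB₂ : 0 ≤ B₂) (hB₂' : 0 ≤ B₂')
    (hD₁ : 0 ≤ D₁) (hD₁' : 0 ≤ D₁') (hD₂ : 0 ≤ D₂) (hD₂' : 0 ≤ D₂')
    (hρ' : 0 ≤ ρ') (hη : 0 ≤ η) (hsplit : ρ' + η ≤ ρ)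
    (hA₁ : ∀ σ : TPt d N' → ℂ, (∀ j, ‖σ j‖ ≤ Real.exp c.κ₁) →
      ∀ i k, ‖KA₁ σ i k‖ ≤ B₁ * Real.exp (-(ρ * tdist1 Nf (locp i) (locq k))))
    (hA₁' : ∀ σ : TPt d N' → ℂ, (∀ j, ‖σ j‖ ≤ Real.exp c.κ₁) →
      ∀ i k, ‖KA₁ σ i k - KA₁ 0 i k‖ ≤ B₁' * Real.exp (-(ρ * distX X (locp i) (locq k))))
    (hB₂d : ∀ σ : TPt d N' → ℂ, (∀ j, ‖σ j‖ ≤ Real.exp c.κ₁) →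
      ∀ k j, ‖KB₂ σ k j‖ ≤ B₂ * Real.exp (-(ρ * tdist1 Nf (locq k) (locn j))))
    (hB₂loc : ∀ σ : TPt d N' → ℂ, (∀ j, ‖σ j‖ ≤ Real.exp c.κ₁) →
      ∀ k j, ‖KB₂ σ k j - KB₂ 0 k j‖ ≤ B₂' * Real.exp (-(ρ * distX X (locq k) (locn j))))
    (hclose₁ : ∀ σ : TPt d N' → ℂ, (∀ j, ‖σ j‖ ≤ Real.exp c.κ₁) →
      ∀ i k, ‖KB₁ σ i k - KA₁ σ i k‖ ≤ ϱ * (D₁ * Real.exp (-(ρ * tdist1 Nf (locp i) (locq k)))))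
    (hloc₁ : ∀ σ : TPt d N' → ℂ, (∀ j, ‖σ j‖ ≤ Real.exp c.κ₁) →
      ∀ i k, ‖(KB₁ σ i k - KB₁ 0 i k) - (KA₁ σ i k - KA₁ 0 i k)‖ ≤ ϱ * (D₁' * Real.exp (-(ρ * distX X (locp i) (locq k)))))
    (hclose₂ : ∀ σ : TPt d N' → ℂ, (∀ j, ‖σ j‖ ≤ Real.exp c.κ₁) →
      ∀ k j, ‖KB₂ σ k j - KA₂ σ k j‖ ≤ ϱ * (D₂ * Real.exp (-(ρ * tdist1 Nf (locq k) (locn j)))))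
    (hloc₂ : ∀ σ : TPt d N' → ℂ, (∀ j, ‖σ j‖ ≤ Real.exp c.κ₁) →
      ∀ k j, ‖(KB₂ σ k j - KB₂ 0 k j) - (KA₂ σ k j - KA₂ 0 k j)‖ ≤ ϱ * (D₂' * Real.exp (-(ρ * distX X (locq k) (locn j)))))
    (hvol : ∀ i, ∑ k, Real.exp (-(η * tdist1 Nf (locp i) (locq k))) ≤ cV)
    (hvol' : ∀ j, ∑ k, Real.exp (-(η * tdist1 Nf (locq k) (locn j))) ≤ cV) :
    ∀ σ : TPt d N' → ℂ, (∀ j, ‖σ j‖ ≤ Real.exp c.κ₁) →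
      ∀ i j, ‖((KB₁ σ * KB₂ σ) i j - (KB₁ 0 * KB₂ 0) i j) - ((KA₁ σ * KA₂ σ) i j - (KA₁ 0 * KA₂ 0) i j)‖
        ≤ ϱ * (((D₁' * B₂ + B₁' * D₂ + D₁ * B₂' + B₁ * D₂') * cV) * Real.exp (-(ρ' * distX X (locp i) (locn j)))) := by
  intro σ hσ i j
  have h0 := zero_mem_polydisc (d := d) (N' := N') c
  -- the four one-line-differenced terms
  have hsplitM : (KB₁ σ * KB₂ σ - KB₁ 0 * KB₂ 0) - (KA₁ σ * KA₂ σ - KA₁ 0 * KA₂ 0) =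
      ((KB₁ σ - KB₁ 0) - (KA₁ σ - KA₁ 0)) * KB₂ σ + (KA₁ σ - KA₁ 0) * (KB₂ σ - KA₂ σ)
        + (KB₁ 0 - KA₁ 0) * (KB₂ σ - KB₂ 0) + KA₁ 0 * ((KB₂ σ - KB₂ 0) - (KA₂ σ - KA₂ 0)) := by
    simp only [Matrix.sub_mul, Matrix.mul_sub]; abel
  have t1 := norm_mul_apply_le_of_decayX_left locp locq locn hX (M₁ := (KB₁ σ - KB₁ 0) - (KA₁ σ - KA₁ 0)) (M₂ := KB₂ σ)
    (a := ϱ * D₁') (b := B₂) (mul_nonneg hϱ hD₁') hB₂ hρ' hη hsplit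
    (fun i k => by rw [Matrix.sub_apply, Matrix.sub_apply, Matrix.sub_apply, mul_assoc]; exact hloc₁ σ hσ i k) (hB₂d σ hσ) hvol' i j
  have t2 := norm_mul_apply_le_of_decayX_left locp locq locn hX (M₁ := KA₁ σ - KA₁ 0) (M₂ := KB₂ σ - KA₂ σ)
    (a := B₁') (b := ϱ * D₂) hB₁' (mul_nonneg hϱ hD₂) hρ' hη hsplit
    (fun i k => by rw [Matrix.sub_apply]; exact hA₁' σ hσ i k)
    (fun k j => by rw [Matrix.sub_apply, mul_assoc]; exact hclose₂ σ hσ k j) hvol' i j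
  have t3 := norm_mul_apply_le_of_decayX_right locp locq locn hX (M₁ := KB₁ 0 - KA₁ 0) (M₂ := KB₂ σ - KB₂ 0)
    (a := ϱ * D₁) (b := B₂') (mul_nonneg hϱ hD₁) hB₂' hρ' hη hsplit
    (fun i k => by rw [Matrix.sub_apply, mul_assoc]; exact hclose₁ 0 h0 i k)
    (fun k j => by rw [Matrix.sub_apply]; exact hB₂loc σ hσ k j) hvol i j
  have t4 := norm_mul_apply_le_of_decayX_right locp locq locn hX (M₁ := KA₁ 0) (M₂ := (KB₂ σ - KB₂ 0) - (KA₂ σ - KA₂ 0))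
    (a := B₁) (b := ϱ * D₂') hB₁ (mul_nonneg hϱ hD₂') hρ' hη hsplit (hA₁ 0 h0)
    (fun k j => by rw [Matrix.sub_apply, Matrix.sub_apply, Matrix.sub_apply, mul_assoc]; exact hloc₂ σ hσ k j) hvol i j
  rw [← Matrix.sub_apply, ← Matrix.sub_apply, ← Matrix.sub_apply, hsplitM, Matrix.add_apply, Matrix.add_apply, Matrix.add_apply]
  set e := Real.exp (-(ρ' * distX X (locp i) (locn j)))
  calc ‖(((KB₁ σ - KB₁ 0) - (KA₁ σ - KA₁ 0)) * KB₂ σ) i j + ((KA₁ σ - KA₁ 0) * (KB₂ σ - KA₂ σ)) i j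
        + ((KB₁ 0 - KA₁ 0) * (KB₂ σ - KB₂ 0)) i j + (KA₁ 0 * ((KB₂ σ - KB₂ 0) - (KA₂ σ - KA₂ 0))) i j‖
      ≤ ‖(((KB₁ σ - KB₁ 0) - (KA₁ σ - KA₁ 0)) * KB₂ σ) i j‖ + ‖((KA₁ σ - KA₁ 0) * (KB₂ σ - KA₂ σ)) i j‖
        + ‖((KB₁ 0 - KA₁ 0) * (KB₂ σ - KB₂ 0)) i j‖ + ‖(KA₁ 0 * ((KB₂ σ - KB₂ 0) - (KA₂ σ - KA₂ 0))) i j‖ := by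
        refine (norm_add_le _ _).trans (add_le_add ((norm_add_le _ _).trans (add_le_add (norm_add_le _ _) le_rfl)) le_rfl)
    _ ≤ ϱ * D₁' * B₂ * cV * e + B₁' * (ϱ * D₂) * cV * e + ϱ * D₁ * B₂' * cV * e + B₁ * (ϱ * D₂') * cV * e :=
        add_le_add (add_le_add (add_le_add t1 t2) t3) t4
    _ = ϱ * (((D₁' * B₂ + B₁' * D₂ + D₁ * B₂' + B₁ * D₂') * cV) * e) := by ring

end Product

end Summit.QuantumFields.YangMills.BalabanUVNodes.N18TwoRunLettersCalculus

end
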